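import Summits.QuantumFields.BalabanUV.Beta.GAN24.FineReadoutDecay
import Summits.QuantumFields.BalabanUV.Beta.GAN24.FineReadoutGradient

/-!
# `BalabanUV.Beta.GAN24.FineReadoutGradientDecay` — binder row G-an2-4 / (CONV-C), S-slot located remainder «E3Shape», road «S3-Taylor» ∕ «S3-fibre²»:
# THE POSITION-SPACE PACKAGING OF leaf-16's (U2″) — leaf-18's (N1′): the `j`-UNIFORM UNIT-GRADIENT BOUND OF BAŁABAN's MINIMISER COLUMN `ℋ`,
# ONE `1/N` BETTER THAN (N1), WITH DECAY ON THE BLOCK SCALE (typer row T-N1p; `SKELETON-S3.md` v1.1 §8∕§12.6; W3's consumption shape)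

NOT IN PRINT; OUR PROOF ATTEMPT (of the road; THIS file is [folklore] packaging — the analytic CONTENT is leaf-16's E3A1–E3A5 chain
`GAN24/FineReadout{Column,Alias,AliasFold,Apriori,Sum,Decay,Gradient}` (unit `b2b-balaban-gan24-formalise-leaf-16`), in particular E3A5
`FineReadoutGradient.norm_sum_ampA_dAl_pw_le` (one lattice curl on the minimiser leg gains exactly one `1/N` in the fibre), fed through pv23's Paley–Wiener
`B4ContourShift.latticeKernel_decay`; the «box-wrap phase identity» that E3A5's header defers is proved here WITHOUT any case split on the wrap: the Bloch
dictionary `FibreDFTDictionary.cfgA_tens_blochChar` holds at EVERY point of `ℤ^{d+1}`, so it is applied at the two honest lattice points `repZ z₀` and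
`repZ z₀ + e_ν` and the block label `quo N (repZ z₀ + e_ν)` carries whatever phase the wrap produces).  HONEST FRAMING (cell contract, verbatim): «discharging
`BetaPertH` makes Bałaban's UV stability UNCONDITIONAL — a real constructive-QFT result; it is NOT the continuum limit and NOT the Clay problem.»  HONEST DEPENDENCY
(verbatim): «continuum YM on T⁴ ⇐ BetaPertH ∧ nine spine estimates (0/9 proved); BetaPertH ⇐ (D1) ∧ (D4) ∧ CAP+tail; G-an2-4 gates asym, D1 and NE2/3/4.»
No cited fact, no wall binder, no `def … : Prop` (the three `def`s are a complex-valued symbol and two displayed real constants, asserting nothing); discharges NOTHING of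
(hS, hSall) ∕ «E3Shape» — (N1′) is ONE leg-shape input (with (N1)) of the Wilson row S3-W and of the DIFF row R3-dW; NOT `BetaPertH`, NOT continuum, NOT Clay.

## What is proved (generic `d`, block side `N ≥ 1`; `wH` = an2's `KernelSpecInstance.wH`, `fibInv` = `CombesThomasFibre.fibInv`)
* §1 THE GRADIENT SYMBOL `gradSym N κ l ν z₀ p := e^{ip·quo N (repZ z₀ + e_ν)}·(F_N(p)⁻¹)_{(κ, proj N (repZ z₀ + e_ν)),(Q,l)} − (F_N(p)⁻¹)_{(κ,z₀),(Q,l)}` and its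
  ALIAS EXPANSION **`gradSym_eq_sum`**: `gradSym N κ l ν z₀ p = Σ_m ampA p v_p m κ · ∂̂_ν(k_m) · pw k_m (repZ z₀)` for EVERY complex `p` (pure DFT: `cfgA_tens_blochChar`
  at `repZ z₀ + e_ν` and at `repZ z₀`, `pw_add_unitVec`; no determinant hypothesis) — the right-hand side is LITERALLY the sum bounded by E3A5.
* §2 **`wH_sub_eq_re_latticeKernel`**: `wH κ l (z + e_ν) − wH κ l z = Re latticeKernel (gradSym N κ l ν (proj N z)) (quo N z)` (an2's `wH_eq_re_latticeKernel` ×2,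
  `eq_repZ_add_zsmul_quo`, pv17's shift rule `B4Green244.latticeKernel_phase_mul`, `B4Green242Bridge.latticeKernel_sub`; integrability from strip holomorphy,
  so `det F_N ≠ 0` on a strip of half-width `κ₀ ≥ 0` is assumed); `stripHolo_gradSym` (leaf-06's `StripRegularPackaging.stripHolo_fibInv`, lit2's `stripHolo_cphase`).
* §3 THE BOUND: `curlFactor d R₀ = π + 1 + 15·K_D·(R₀²·C₀ + R₀³·C₋₁)` (E3A5's constant at border-radius envelope `R₀`), `fineM₁ d N κ₀ A R₀ = e^{(d+1)κ₀}·A·(N^{d+2})⁻¹·N⁻¹·curlFactor`,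
  `norm_gradSym_le_fineM₁` (E3A5 through §1, monotone in `r₀ ≤ R₀`), **`stripRegular_gradSym`**, and **`abs_wH_sub_le`**: under (U1) + scaled a-priori pairs on
  `Strip (d+1) κ₀` (`0 < κ₀ ≤ 1/4`, `(3(d+1)/2+2)κ₀ ≤ 1/2`), `|wH κ l (z + e_ν) − wH κ l z| ≤ fineM₁ · e^{−κ₀‖quo N z‖∞}` for EVERY fine bond and direction.
* §4 `radO_zero_le_sqrt_mul_pi` (the generic-`d` radius envelope `radO N q 0 ≤ √(d+1)·π`; leaf-09's `radO_zero_le_two_pi` is its `d = 3` case) and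
  **`exists_wH_grad_decay`** (generic `d`, every blocking factor `Lc ≥ 1`, all levels `N = Lc^(j+1)`, ONE `(κ₀, C′)`; inputs leaf-09's
  `FibreDetStripHolds.exists_strip` BY NAME, exactly as in leaf-16's `exists_wH_decay`):
  `∃ κ₀ C′, 0 < κ₀ ∧ 0 ≤ C′ ∧ ∀ j κ l z ν, |wH (N := Lc^(j+1)) κ l (z + Pi.single ν 1) − wH κ l z| ≤ C′·((Lc^(j+1))^{d+3})⁻¹·e^{−κ₀‖quo (Lc^(j+1)) z‖∞}` — leaf-18's (N1′);
  and at `d = 3` the JOINT form **`exists_wH_decay_and_grad`** ((N1) ∧ (N1′) with ONE common rate — the two hypotheses `hN1`, `hN1'` of the row-W assembly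
  `TaylorRowW.rowW_of_supNorm_forms` and of row dW, literally).
Unit `b2b-balaban-gan24-formalise-leaf-19` (G-an2-4 formalisation swarm, leaf prover 19, gen 14; ROW S3-W holder), 2026-08-20.
-/

noncomputable section

open Complex Finset Matrix MeasureTheory
open scoped BigOperators Real Matrix.Norms.L2Operator
open Literature.Probability.LatticeModels (TorusSite Torus.proj)
open Literature.MathematicalPhysics.QuantumFieldTheory.LatticeForm (quo repZ proj_repZ proj_add_zsmul)
open Literature.MathematicalPhysics.QuantumFieldTheory.Balaban1983to89
open Literature.MathematicalPhysics.QuantumFieldTheory.Balaban1983to89.Beta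
open Literature.MathematicalPhysics.QuantumFieldTheory.King1986 (aliasConst momSq momSq_le_card_mul_pi_sq)
open AffineAveraging (Site unitVec)
open B4Strip (Strip reVec)
open B4ContourShift (BZ StripRegular integrand latticeKernel supNorm supNorm_nonneg latticeKernel_decay)
open B4Green244 (latticeKernel_phase_mul)
open B4Green242Bridge (latticeKernel_sub)
open BlochFibreMatrix (Idx stencil pieceMatrix cfgA tens blochChar blochChar_apply eq_repZ_add_zsmul_quo)
open BlochFibreUniqueness (quo_repZ quo_add_zsmul)
open FibreInverseDecay (trigPolySymbol StripHolo cphase stripHolo_cphase stripHolo_const cphase_eq_phaseC)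
open KernelSpecInstance (wH)
open Summit.QuantumFields.BalabanUV.Beta.GAN24.FibreSymbols (pw dhat pw_add_unitVec)
open Summit.QuantumFields.BalabanUV.Beta.GAN24.FibreDFT (kFine)
open Summit.QuantumFields.BalabanUV.Beta.GAN24.FibreDFTDictionary (ampA cfgA_tens_blochChar)
open Summit.QuantumFields.BalabanUV.Beta.GAN24.AliasObjects (dAl)
open Summit.QuantumFields.BalabanUV.Beta.GAN24.ArrowOperator (arrowMat)
open Summit.QuantumFields.BalabanUV.Beta.GAN24.AliasWeights (kfine)
open Summit.QuantumFields.BalabanUV.Beta.GAN24.AliasWeightsSum (lapR)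
open Summit.QuantumFields.BalabanUV.Beta.GAN24.ArrowScaling (scaledArrow radI radO radI_pos radO_pos sq_radO)
open Summit.QuantumFields.BalabanUV.Beta.GAN24.CapacitanceScalarBounds (sq_mul_lapR_zero_le)
open Summit.QuantumFields.BalabanUV.Beta.GAN24.CombesThomasFibre (fibInv wH_eq_re_latticeKernel)
open Summit.QuantumFields.BalabanUV.Beta.GAN24.StripRegularPackaging (stripHolo_fibInv stripRegular_of_stripHolo)
open Summit.QuantumFields.BalabanUV.Beta.GAN24.FibreDetStripHolds (exists_strip strip_mono)
open Summit.QuantumFields.BalabanUV.Beta.GAN24.FineReadoutDecay (aliasConst_nonneg exists_wH_decay)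
open Summit.QuantumFields.BalabanUV.Beta.GAN24.FineReadoutGradient (norm_sum_ampA_dAl_pw_le)

namespace Summit.QuantumFields.BalabanUV.Beta.GAN24.FineReadoutGradientDecay

/-! ## §1 The gradient symbol and its alias expansion (pure DFT, every complex quasi-momentum) -/

section Symbol

variable {d N : ℕ} [NeZero N]

/-- [folklore] THE GRADIENT SYMBOL of the minimiser column at the fine site `z₀` of the box, direction `ν`, multiplier source `e_{(Q,l)}`, field
reading `κ`: `e^{ip·quo N (repZ z₀ + e_ν)}·(F_N(p)⁻¹)_{(κ, proj N (repZ z₀ + e_ν)),(Q,l)} − (F_N(p)⁻¹)_{(κ, z₀),(Q,l)}` — the block label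
`quo N (repZ z₀ + e_ν) ∈ {0, e_ν}` of the shifted point carries the box-wrap phase. -/
def gradSym (N : ℕ) [NeZero N] (κ l ν : Fin (d + 1)) (z₀ : TorusSite (d + 1) N) (p : Fin (d + 1) → ℂ) : ℂ :=
  cphase (quo N (repZ z₀ + unitVec ν)) p * fibInv N (Sum.inl (κ, Torus.proj N (repZ z₀ + unitVec ν))) (Sum.inr (Sum.inr l)) p
    - fibInv N (Sum.inl (κ, z₀)) (Sum.inr (Sum.inr l)) p

/-- [folklore] lit2's character is an2's Bloch character: `cphase a p = blochChar p a`. -/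
theorem cphase_eq_blochChar (a : Fin (d + 1) → ℤ) (p : Fin (d + 1) → ℂ) : cphase a p = blochChar p a := by
  rw [blochChar_apply]; rfl

/-- [folklore] The Bloch dictionary read on the minimiser column: at EVERY fine point `x ∈ ℤ^{d+1}`,
`blochChar p (quo N x) · (F_N(p)⁻¹)_{(κ, proj N x),(Q,l)} = Σ_m ampA p v_p m κ · pw k_m x`. -/
theorem blochChar_mul_fibInv_eq_sum (κ l : Fin (d + 1)) (p : Fin (d + 1) → ℂ) (x : Site (d + 1)) :
    blochChar p (quo N x) * fibInv N (Sum.inl (κ, Torus.proj N x)) (Sum.inr (Sum.inr l)) p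
      = ∑ m : TorusSite (d + 1) N, ampA p (fun i => fibInv N i (Sum.inr (Sum.inr l)) p) m κ * pw (kFine p m) x :=
  cfgA_tens_blochChar p (fun i => fibInv N i (Sum.inr (Sum.inr l)) p) κ x

/-- [folklore] **THE ALIAS EXPANSION OF THE GRADIENT SYMBOL** («box-wrap phase identity», with no case split): for EVERY complex `p`,
`gradSym N κ l ν z₀ p = Σ_m ampA p v_p m κ · ∂̂_ν(k_m) · pw k_m (repZ z₀)` with `v_p = F_N(p)⁻¹ e_{(Q,l)}` — LITERALLY the sum of
`FineReadoutGradient.norm_sum_ampA_dAl_pw_le`. -/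
theorem gradSym_eq_sum (κ l ν : Fin (d + 1)) (z₀ : TorusSite (d + 1) N) (p : Fin (d + 1) → ℂ) :
    gradSym N κ l ν z₀ p = ∑ m : TorusSite (d + 1) N,
      ampA p (fun i => fibInv N i (Sum.inr (Sum.inr l)) p) m κ * dAl N p m ν * pw (kFine p m) (repZ z₀) := by
  have h1 := blochChar_mul_fibInv_eq_sum (N := N) κ l p (repZ z₀ + unitVec ν)
  have h0 := blochChar_mul_fibInv_eq_sum (N := N) κ l p (repZ z₀)
  rw [quo_repZ, AddChar.map_zero_eq_one, one_mul, proj_repZ] at h0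
  unfold gradSym
  rw [cphase_eq_blochChar, h1, h0, ← Finset.sum_sub_distrib]
  refine Finset.sum_congr rfl fun m _ => ?_
  have hd : dAl N p m ν = cexp (I * kFine p m ν) - 1 := rfl
  rw [pw_add_unitVec, hd]
  ring

end Symbol

/-! ## §2 The position-space forward difference of `ℋ` is the lattice kernel of the gradient symbol -/

section Position

variable {d N : ℕ} [NeZero N]

/-- [folklore] The gradient symbol is strip holomorphic wherever the fibre determinant has no zero on the strip. -/
theorem stripHolo_gradSym {κ₀ : ℝ} (hκ0 : 0 ≤ κ₀)
    (hdet : ∀ p ∈ Strip (d + 1) κ₀, (trigPolySymbol (stencil (d + 1)) (pieceMatrix (N := N)) p).det ≠ 0)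
    (κ l ν : Fin (d + 1)) (z₀ : TorusSite (d + 1) N) : StripHolo (gradSym N κ l ν z₀) κ₀ := by
  have h := ((stripHolo_cphase (quo N (repZ z₀ + unitVec ν)) κ₀).mul
      (stripHolo_fibInv hκ0 hdet (Sum.inl (κ, Torus.proj N (repZ z₀ + unitVec ν))) (Sum.inr (Sum.inr l)))).add
    ((stripHolo_const (-1 : ℂ) κ₀).mul (stripHolo_fibInv hκ0 hdet (Sum.inl (κ, z₀)) (Sum.inr (Sum.inr l))))
  have hfun : gradSym N κ l ν z₀ = fun p =>
      cphase (quo N (repZ z₀ + unitVec ν)) p * fibInv N (Sum.inl (κ, Torus.proj N (repZ z₀ + unitVec ν))) (Sum.inr (Sum.inr l)) p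
        + (-1) * fibInv N (Sum.inl (κ, z₀)) (Sum.inr (Sum.inr l)) p := by
    funext p; unfold gradSym; ring
  rw [hfun]
  exact h

/-- [folklore] A strip-holomorphic multiplier (`κ ≥ 0`) has an integrable integrand on the real zone. -/
theorem integrableOn_of_stripHolo {G : (Fin (d + 1) → ℂ) → ℂ} {κ : ℝ} (h : StripHolo G κ) (hκ : 0 ≤ κ) (x : Fin (d + 1) → ℤ) :
    IntegrableOn (integrand G x) (BZ (d + 1)) := by
  obtain ⟨M, -, hR⟩ := h.exists_stripRegular
  exact hR.integrableOn hκ x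

/-- [folklore] **THE FORWARD DIFFERENCE OF THE MINIMISER COLUMN IS THE LATTICE KERNEL OF THE GRADIENT SYMBOL, READ AT THE BLOCK LABEL**:
`wH κ l (z + e_ν) − wH κ l z = Re (2π)^{−(d+1)} ∫ gradSym N κ l ν (proj N z) (p) e^{ip·quo N z} dp` (`det F_N ≠ 0` on a strip of half-width `κ₀ ≥ 0`
only for integrability).  The shifted block label `quo N (z + e_ν) = quo N z + quo N (repZ (proj N z) + e_ν)` is moved into the multiplier by the shift rule. -/
theorem wH_sub_eq_re_latticeKernel {κ₀ : ℝ} (hκ0 : 0 ≤ κ₀)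
    (hdet : ∀ p ∈ Strip (d + 1) κ₀, (trigPolySymbol (stencil (d + 1)) (pieceMatrix (N := N)) p).det ≠ 0)
    (κ l ν : Fin (d + 1)) (z : Fin (d + 1) → ℤ) :
    wH (N := N) κ l (z + unitVec ν) - wH (N := N) κ l z = (latticeKernel (gradSym N κ l ν (Torus.proj N z)) (quo N z)).re := by
  have hz : z + unitVec ν = repZ (Torus.proj N z) + unitVec ν + (N : ℤ) • quo N z :=
    calc z + unitVec ν = repZ (Torus.proj N z) + (N : ℤ) • quo N z + unitVec ν :=
          congrArg (· + unitVec ν) (eq_repZ_add_zsmul_quo (N := N) z)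
      _ = repZ (Torus.proj N z) + unitVec ν + (N : ℤ) • quo N z := add_right_comm _ _ _
  -- the shifted multiplier, written with `B4Green244.phaseC` as the shift rule states it (`cphase a P = cexp (I·phaseC P a)` by `rfl`)
  have hint₁ : IntegrableOn (integrand (fun P => cexp (I * B4Green244.phaseC P (quo N (repZ (Torus.proj N z) + unitVec ν))) *
      fibInv N (Sum.inl (κ, Torus.proj N (repZ (Torus.proj N z) + unitVec ν))) (Sum.inr (Sum.inr l)) P) (quo N z)) (BZ (d + 1)) :=
    integrableOn_of_stripHolo ((stripHolo_cphase (quo N (repZ (Torus.proj N z) + unitVec ν)) κ₀).mul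
      (stripHolo_fibInv hκ0 hdet (Sum.inl (κ, Torus.proj N (repZ (Torus.proj N z) + unitVec ν))) (Sum.inr (Sum.inr l)))) hκ0 (quo N z)
  have hint₂ := integrableOn_of_stripHolo (stripHolo_fibInv hκ0 hdet (Sum.inl (κ, Torus.proj N z)) (Sum.inr (Sum.inr l))) hκ0 (quo N z)
  rw [wH_eq_re_latticeKernel, wH_eq_re_latticeKernel, hz, proj_add_zsmul, quo_add_zsmul, add_comm (quo N _) (quo N z),
    ← latticeKernel_phase_mul, ← Complex.sub_re, ← latticeKernel_sub _ hint₁ hint₂]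
  rfl

end Position

/-! ## §3 The bound on the strip: E3A5 through the alias expansion; strip regularity; the pointwise gradient bound -/

section Bound

variable {d N : ℕ} [NeZero N]

/-- [folklore] E3A5's constant at border-radius envelope `R₀`: `π + 1 + 15·K_D·(R₀²·C₀ + R₀³·C₋₁)`, `K_D = √12^D·√6·(1+8D)`,
`C₀ = (3π)·3^D·aliasConst D 0`, `C₋₁ = (3π)²·3^D·aliasConst D (−1)`, `D = d+1`. -/
def curlFactor (d : ℕ) (R0 : ℝ) : ℝ :=
  π + 1 + 15 * (Real.sqrt 12 ^ (d + 1) * (Real.sqrt 6 * (1 + 8 * (d + 1 : ℕ)))) *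
    (R0 ^ 2 * ((3 * π) ^ (1 - (0 : ℝ)) * (3 : ℝ) ^ (d + 1) * aliasConst (d + 1) 0)
      + R0 ^ 3 * ((3 * π) ^ (1 - (-1 : ℝ)) * (3 : ℝ) ^ (d + 1) * aliasConst (d + 1) (-1)))

/-- [folklore] THE SUP BOUND of the gradient symbol at block side `N`: `fineM₁ = e^{(d+1)κ₀}·A·(N^{d+2})⁻¹·N⁻¹·curlFactor d R₀` — ONE `1/N` better than
`FineReadoutDecay.fineM`. -/
def fineM₁ (d N : ℕ) (κ₀ A R0 : ℝ) : ℝ := Real.exp ((d + 1) * κ₀) * A * ((N : ℝ) ^ (d + 1 + 1))⁻¹ * (N : ℝ)⁻¹ * curlFactor d R0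

/-- [folklore] `curlFactor` is monotone in the radius envelope on `[0, ∞)`. -/
theorem curlFactor_mono {R0 R0' : ℝ} (h0 : 0 ≤ R0) (h : R0 ≤ R0') : curlFactor d R0 ≤ curlFactor d R0' := by
  unfold curlFactor
  have hC0 : 0 ≤ (3 * π) ^ (1 - (0 : ℝ)) * (3 : ℝ) ^ (d + 1) * aliasConst (d + 1) 0 :=
    mul_nonneg (by positivity) (aliasConst_nonneg (Nat.succ_pos d) (by norm_num))
  have hC1 : 0 ≤ (3 * π) ^ (1 - (-1 : ℝ)) * (3 : ℝ) ^ (d + 1) * aliasConst (d + 1) (-1) :=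
    mul_nonneg (by positivity) (aliasConst_nonneg (Nat.succ_pos d) (by norm_num))
  have h2 : R0 ^ 2 ≤ R0' ^ 2 := pow_le_pow_left₀ h0 h 2
  have h3 : R0 ^ 3 ≤ R0' ^ 3 := pow_le_pow_left₀ h0 h 3
  have hK : 0 ≤ Real.sqrt 12 ^ (d + 1) * (Real.sqrt 6 * (1 + 8 * (d + 1 : ℕ))) := by positivity
  nlinarith [mul_le_mul_of_nonneg_right h2 hC0, mul_le_mul_of_nonneg_right h3 hC1]

/-- [folklore] `0 ≤ curlFactor d R₀` for `R₀ ≥ 0`. -/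
theorem curlFactor_nonneg {R0 : ℝ} (h0 : 0 ≤ R0) : 0 ≤ curlFactor d R0 := by
  unfold curlFactor
  have hC0 : 0 ≤ (3 * π) ^ (1 - (0 : ℝ)) * (3 : ℝ) ^ (d + 1) * aliasConst (d + 1) 0 :=
    mul_nonneg (by positivity) (aliasConst_nonneg (Nat.succ_pos d) (by norm_num))
  have hC1 : 0 ≤ (3 * π) ^ (1 - (-1 : ℝ)) * (3 : ℝ) ^ (d + 1) * aliasConst (d + 1) (-1) :=
    mul_nonneg (by positivity) (aliasConst_nonneg (Nat.succ_pos d) (by norm_num))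
  positivity

omit [NeZero N] in
/-- [folklore] `0 ≤ fineM₁`. -/
theorem fineM₁_nonneg {κ₀ A R0 : ℝ} (hA : 0 ≤ A) (hR0 : 0 ≤ R0) : 0 ≤ fineM₁ d N κ₀ A R0 := by
  unfold fineM₁
  have := curlFactor_nonneg (d := d) hR0
  positivity

/-- [folklore] **E3A5 AT A STRIP POINT, IN POSITION-READY FORM**: with a scaled a-priori pair of border radius `r₀ ≤ R₀` at `p`,
`‖gradSym N κ l ν z₀ p‖ ≤ fineM₁ d N κ₀ A R₀` (`gradSym_eq_sum` + `FineReadoutGradient.norm_sum_ampA_dAl_pw_le` + monotonicity in `r₀`). -/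
theorem norm_gradSym_le_fineM₁ {κ₀ A R0 : ℝ} (hκ : 0 ≤ κ₀) (hκ4 : κ₀ ≤ 1 / 4) (hκD : (3 * (d + 1 : ℕ) / 2 + 2) * κ₀ ≤ 1 / 2) (hA : 0 ≤ A)
    {p : Fin (d + 1) → ℂ} (hp : p ∈ Strip (d + 1) κ₀) (hdet : (trigPolySymbol (stencil (d + 1)) (pieceMatrix (N := N)) p).det ≠ 0)
    {r : TorusSite (d + 1) N → ℝ} (hr : ∀ m, 0 < r m) {r0 : ℝ} (hr0 : 0 < r0) (hr0R : r0 ≤ R0)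
    (hU : IsUnit (arrowMat (scaledArrow N r r0 p))) (hAi : ‖(arrowMat (scaledArrow N r r0 p))⁻¹‖ ≤ A)
    (κ l ν : Fin (d + 1)) (z₀ : TorusSite (d + 1) N) :
    ‖gradSym N κ l ν z₀ p‖ ≤ fineM₁ d N κ₀ A R0 := by
  rw [gradSym_eq_sum]
  have h := norm_sum_ampA_dAl_pw_le (fun i => (hp i).1) (fun i => (hp i).2) hκ hκ4 hκD hdet hr hr0 hA hU hAi l κ ν z₀
  refine h.trans ?_
  have hK := curlFactor_mono (d := d) hr0.le hr0R
  unfold fineM₁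
  unfold curlFactor at hK
  have hE : 0 ≤ Real.exp ((d + 1) * κ₀) * A * ((N : ℝ) ^ (d + 1 + 1))⁻¹ * (N : ℝ)⁻¹ := by positivity
  exact mul_le_mul_of_nonneg_left hK hE

/-- [folklore] **`StripRegular` OF THE GRADIENT SYMBOL** from a det-free strip carrying scaled a-priori pairs (inner or outer, border radius `≤ R₀`). -/
theorem stripRegular_gradSym {κ₀ A R0 : ℝ} (hκ0 : 0 < κ₀) (hκ4 : κ₀ ≤ 1 / 4) (hκD : (3 * (d + 1 : ℕ) / 2 + 2) * κ₀ ≤ 1 / 2)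
    (hA : 0 ≤ A) (_hR0 : 0 < R0)
    (hdet : ∀ p ∈ Strip (d + 1) κ₀, (trigPolySymbol (stencil (d + 1)) (pieceMatrix (N := N)) p).det ≠ 0)
    (hpair : ∀ p ∈ Strip (d + 1) κ₀, ∃ (r : TorusSite (d + 1) N → ℝ) (r0 : ℝ), (∀ m, 0 < r m) ∧ 0 < r0 ∧ r0 ≤ R0 ∧
      IsUnit (arrowMat (scaledArrow N r r0 p)) ∧ ‖(arrowMat (scaledArrow N r r0 p))⁻¹‖ ≤ A)
    (κ l ν : Fin (d + 1)) (z₀ : TorusSite (d + 1) N) :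
    StripRegular (gradSym N κ l ν z₀) κ₀ (fineM₁ d N κ₀ A R0) := by
  refine stripRegular_of_stripHolo (stripHolo_gradSym hκ0.le hdet κ l ν z₀) fun p hp => ?_
  obtain ⟨r, r0, hr, hr0, hr0R, hU, hAi⟩ := hpair p hp
  exact norm_gradSym_le_fineM₁ hκ0.le hκ4 hκD hA hp (hdet p hp) hr hr0 hr0R hU hAi κ l ν z₀

/-- [folklore] **(N1′) AT BLOCK SIDE `N`**: Paley–Wiener on the block label — `|wH κ l (z + e_ν) − wH κ l z| ≤ fineM₁ · e^{−κ₀‖quo N z‖∞}` for EVERY fine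
bond `(κ, z)` and every direction `ν`. -/
theorem abs_wH_sub_le {κ₀ A R0 : ℝ} (hκ0 : 0 < κ₀) (hκ4 : κ₀ ≤ 1 / 4) (hκD : (3 * (d + 1 : ℕ) / 2 + 2) * κ₀ ≤ 1 / 2)
    (hA : 0 ≤ A) (hR0 : 0 < R0)
    (hdet : ∀ p ∈ Strip (d + 1) κ₀, (trigPolySymbol (stencil (d + 1)) (pieceMatrix (N := N)) p).det ≠ 0)
    (hpair : ∀ p ∈ Strip (d + 1) κ₀, ∃ (r : TorusSite (d + 1) N → ℝ) (r0 : ℝ), (∀ m, 0 < r m) ∧ 0 < r0 ∧ r0 ≤ R0 ∧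
      IsUnit (arrowMat (scaledArrow N r r0 p)) ∧ ‖(arrowMat (scaledArrow N r r0 p))⁻¹‖ ≤ A)
    (κ l ν : Fin (d + 1)) (z : Fin (d + 1) → ℤ) :
    |wH (N := N) κ l (z + unitVec ν) - wH (N := N) κ l z| ≤ fineM₁ d N κ₀ A R0 * Real.exp (-(κ₀ * supNorm (quo N z))) := by
  rw [wH_sub_eq_re_latticeKernel hκ0.le hdet]
  refine (Complex.abs_re_le_norm _).trans ?_
  exact latticeKernel_decay (stripRegular_gradSym hκ0 hκ4 hκD hA hR0 hdet hpair κ l ν (Torus.proj N z)) hκ0.le _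

end Bound

/-! ## §4 Every level, unconditionally, from road P1's (U1)+A: leaf-18's (N1′); and the joint (N1) ∧ (N1′) at `d = 3` -/

section Levels

variable {d Lc : ℕ} [NeZero Lc]

/-- [folklore] THE OUTER ZERO-ALIAS RADIUS IS AT MOST `√(d+1)·π` on `[−π,π]^{d+1}` (`(radO)² = N²·lapR ≤ |q|² ≤ (d+1)π²`; the generic-`d` form of leaf-09's
`StripLegApriori.radO_zero_le_two_pi`, same two inputs BY NAME). -/
theorem radO_zero_le_sqrt_mul_pi {N : ℕ} [NeZero N] {q : Fin (d + 1) → ℝ} (hq : ∀ i, |q i| ≤ π) :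
    radO N q 0 ≤ Real.sqrt ((d + 1 : ℕ) : ℝ) * π := by
  have hN : 1 ≤ N := Nat.one_le_iff_ne_zero.2 (NeZero.ne N)
  have h1 : radO N q 0 ^ 2 ≤ (Real.sqrt ((d + 1 : ℕ) : ℝ) * π) ^ 2 := by
    rw [sq_radO, mul_pow, Real.sq_sqrt (by positivity)]
    calc (N : ℝ) ^ 2 * lapR (kfine N q 0) ≤ momSq q := sq_mul_lapR_zero_le hN q
      _ ≤ ((d + 1 : ℕ) : ℝ) * π ^ 2 := momSq_le_card_mul_pi_sq hq
  have h0 : 0 ≤ radO N q 0 := by unfold radO; positivity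
  exact (pow_le_pow_iff_left₀ h0 (by positivity) two_ne_zero).1 h1

/-- [folklore] **leaf-18's (N1′), UNCONDITIONAL, EVERY `d`**: ONE rate `κ₀ > 0` and ONE constant `C′` such that for EVERY level `N = Lc^(j+1)`, every fine bond and every
direction, `|wH (N := Lc^(j+1)) κ l (z + e_ν) − wH κ l z| ≤ C′ · ((Lc^(j+1))^{d+3})⁻¹ · e^{−κ₀‖quo (Lc^(j+1)) z‖∞}` — the unit gradient of the minimiser column of
Bałaban's `U = 1` block-spin map is `O(N^{−(d+3)})` pointwise with exponential decay on the BLOCK scale, uniformly in the level (inputs: leaf-09's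
`FibreDetStripHolds.exists_strip` BY NAME; strip shrunk to `κ₁ = min κ₀ (1/(3(d+1)+4))`, radius envelope `R₀ = √(d+1)·π`). -/
theorem exists_wH_grad_decay :
    ∃ κ₀ C' : ℝ, 0 < κ₀ ∧ 0 ≤ C' ∧ ∀ (j : ℕ) (κ l : Fin (d + 1)) (z : Fin (d + 1) → ℤ) (ν : Fin (d + 1)),
      |wH (N := Lc ^ (j + 1)) κ l (z + Pi.single ν 1) - wH (N := Lc ^ (j + 1)) κ l z|
        ≤ C' * (((Lc ^ (j + 1) : ℕ) : ℝ) ^ (d + 3))⁻¹ * Real.exp (-(κ₀ * supNorm (quo (Lc ^ (j + 1)) z))) := by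
  obtain ⟨ρ₀, κ₀, A, hρ₀, hκ₀, _hκρ, hκ4, hA, hdet, hpair⟩ := exists_strip (d := d) (Lc := Lc)
  -- shrink the strip so that E3A2's relative bound applies: (3(d+1)/2 + 2)·κ₁ ≤ 1/2
  set T : ℝ := 3 * ((d + 1 : ℕ) : ℝ) + 4 with hT
  have hTpos : 0 < T := by rw [hT]; positivity
  have hT7 : 7 ≤ T := by
    rw [hT]; have : (1 : ℝ) ≤ ((d + 1 : ℕ) : ℝ) := by exact_mod_cast Nat.succ_pos d
    linarith
  set κ₁ : ℝ := min κ₀ (1 / T) with hκ₁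
  have hκ₁0 : 0 < κ₁ := lt_min hκ₀ (by positivity)
  have hκ₁le : κ₁ ≤ κ₀ := min_le_left _ _
  have hκ₁T : κ₁ ≤ 1 / T := min_le_right _ _
  have hκ₁4 : κ₁ ≤ 1 / 4 := hκ₁T.trans (one_div_le_one_div_of_le (by norm_num) (by linarith))
  have hκ₁D : (3 * (d + 1 : ℕ) / 2 + 2) * κ₁ ≤ 1 / 2 := by
    have h1 : (3 * ((d + 1 : ℕ) : ℝ) / 2 + 2) = T / 2 := by rw [hT]; ring
    rw [h1]
    calc T / 2 * κ₁ ≤ T / 2 * (1 / T) := mul_le_mul_of_nonneg_left hκ₁T (by positivity)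
      _ = 1 / 2 := by field_simp
  set R0 : ℝ := Real.sqrt ((d + 1 : ℕ) : ℝ) * π with hR0
  have hR0one : 1 ≤ R0 := by
    rw [hR0]
    have h1 : 1 ≤ Real.sqrt ((d + 1 : ℕ) : ℝ) := Real.one_le_sqrt.2 (by exact_mod_cast Nat.succ_pos d)
    have hπ := Real.pi_gt_three
    nlinarith
  have hR0pos : 0 < R0 := lt_of_lt_of_le one_pos hR0one
  refine ⟨κ₁, Real.exp ((d + 1) * κ₁) * A * curlFactor d R0, hκ₁0, ?_, fun j κ l z ν => ?_⟩
  · have := curlFactor_nonneg (d := d) hR0pos.le; positivity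
  haveI : NeZero (Lc ^ (j + 1)) := ⟨pow_ne_zero _ (NeZero.ne Lc)⟩
  have hdet₁ : ∀ p ∈ Strip (d + 1) κ₁, (trigPolySymbol (stencil (d + 1)) (pieceMatrix (N := Lc ^ (j + 1))) p).det ≠ 0 :=
    strip_mono hκ₁le (hdet j)
  have hpair₁ : ∀ p ∈ Strip (d + 1) κ₁, ∃ (r : TorusSite (d + 1) (Lc ^ (j + 1)) → ℝ) (r0 : ℝ), (∀ m, 0 < r m) ∧ 0 < r0 ∧ r0 ≤ R0 ∧
      IsUnit (arrowMat (scaledArrow (Lc ^ (j + 1)) r r0 p)) ∧ ‖(arrowMat (scaledArrow (Lc ^ (j + 1)) r r0 p))⁻¹‖ ≤ A := by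
    intro p hp
    have hq : ∀ i, |reVec p i| ≤ π := fun i => (hp i).1
    rcases strip_mono hκ₁le (hpair j) p hp with ⟨_, hU, hAi⟩ | ⟨_, _, hq0, hU, hAi⟩
    · exact ⟨radI (Lc ^ (j + 1)), 1, radI_pos, one_pos, hR0one, hU, hAi⟩
    · exact ⟨radO (Lc ^ (j + 1)) (reVec p), radO (Lc ^ (j + 1)) (reVec p) 0, radO_pos hq hq0, radO_pos hq hq0 0,
        radO_zero_le_sqrt_mul_pi hq, hU, hAi⟩
  have h := abs_wH_sub_le (N := Lc ^ (j + 1)) hκ₁0 hκ₁4 hκ₁D hA hR0pos hdet₁ hpair₁ κ l ν z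
  refine h.trans (le_of_eq ?_)
  unfold fineM₁
  push_cast
  ring

/-- [folklore] Weakening the decay rate: `e^{−κ s} ≤ e^{−κ′ s}` for `κ′ ≤ κ` and `s ≥ 0`. -/
theorem exp_neg_mul_le_of_le {κ κ' s : ℝ} (h : κ' ≤ κ) (hs : 0 ≤ s) : Real.exp (-(κ * s)) ≤ Real.exp (-(κ' * s)) := by
  rw [Real.exp_le_exp]; nlinarith

/-- [folklore] **(N1) ∧ (N1′) JOINTLY AT `d = 3`, ONE COMMON RATE** — the two located leg inputs of the Wilson row S3-W (the hypotheses `hN1`, `hN1'` of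
`TaylorRowW.rowW_of_supNorm_forms`, LITERALLY) and of the DIFF row R3-dW: leaf-16's `FineReadoutDecay.exists_wH_decay` and `exists_wH_grad_decay` above at the
smaller of their two rates. -/
theorem exists_wH_decay_and_grad :
    ∃ κ₀ C C' : ℝ, 0 < κ₀ ∧ 0 ≤ C ∧ 0 ≤ C' ∧
      (∀ (j : ℕ) (κ l : Fin (3 + 1)) (z : Fin (3 + 1) → ℤ), |wH (N := Lc ^ (j + 1)) κ l z| ≤
        C * ((((Lc ^ (j + 1) : ℕ) : ℝ)) ^ (3 + 2))⁻¹ * Real.exp (-(κ₀ * supNorm (quo (Lc ^ (j + 1)) z)))) ∧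
      (∀ (j : ℕ) (κ l : Fin (3 + 1)) (z : Fin (3 + 1) → ℤ) (ν : Fin (3 + 1)),
        |wH (N := Lc ^ (j + 1)) κ l (z + Pi.single ν 1) - wH (N := Lc ^ (j + 1)) κ l z| ≤
          C' * ((((Lc ^ (j + 1) : ℕ) : ℝ)) ^ (3 + 3))⁻¹ * Real.exp (-(κ₀ * supNorm (quo (Lc ^ (j + 1)) z)))) := by
  obtain ⟨κa, C, hκa, hC, hN1⟩ := exists_wH_decay (Lc := Lc)
  obtain ⟨κb, C', hκb, hC', hN1'⟩ := exists_wH_grad_decay (d := 3) (Lc := Lc)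
  refine ⟨min κa κb, C, C', lt_min hκa hκb, hC, hC', fun j κ l z => ?_, fun j κ l z ν => ?_⟩
  · refine (hN1 j κ l z).trans ?_
    exact mul_le_mul_of_nonneg_left (exp_neg_mul_le_of_le (min_le_left _ _) (supNorm_nonneg _)) (by positivity)
  · refine (hN1' j κ l z ν).trans ?_
    exact mul_le_mul_of_nonneg_left (exp_neg_mul_le_of_le (min_le_right _ _) (supNorm_nonneg _)) (by positivity)

end Levels

end Summit.QuantumFields.BalabanUV.Beta.GAN24.FineReadoutGradientDecay

end
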